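import Literature.MathematicalPhysics.QuantumFieldTheory.Federbush1986.LandauPenaltyFibre
import Literature.MathematicalPhysics.QuantumFieldTheory.Federbush1986.LandauModeBondMultipliers
import Mathlib.Analysis.Distribution.SchwartzSpace.Fourier

/-!
# `Federbush1986.LandauPenaltyDictionary` — [Federbush1986PhaseCellI] §3 p. 327–328: the position ↔ momentum-fibre
# dictionary behind «We now exhibit the Fourier transform of C = D⁻¹» (3.6) — PROVED on the core of smooth compactly
# supported fields: (3.4) `S = ∫_cell S_p dp`, (3.5) `(DA)~|_p = D_p(Ã|_p)`, hence (3.6) `C_p[(DA)~|_p] = Ã|_p`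

statement-level skeleton of published theorems with citation tags; proofs where landed; nothing here is a claim about the Yang–Mills mass gap

CITATION HEADER.  P. Federbush, *A phase cell approach to Yang–Mills theory. I. Modes, lattice-continuum duality*, Commun.
Math. Phys. **107** (1986) 319–329 [Federbush1986PhaseCellI], §3 «The Potential A_μ(x) of a Single Excitation», p. 327–328,
displays (3.3)–(3.7), (3.9)–(3.12) (page images `run/shared/lean/pub/lit-balaban/lit-balaban-r17/renders/fedI/`);
P. Federbush, C. Williamson, *II*, J. Math. Phys. **28** (1987) 1416–1419 [FederbushWilliamson1987PhaseCellII], (1.4), (3.1),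
(6.8); E. M. Stein, G. Weiss, *Introduction to Fourier Analysis on Euclidean Spaces* (1971) [SteinWeiss1971], Ch. I Thm 2.1
(Plancherel), Ch. VII §1 Thm 1.7 / §2 Thm 2.4 (Fourier series on the torus, Poisson summation).  Unit `lit-balaban-r17` gen 58
(fold owner of the Federbush block), SKELETON rows **F1.Eq3.2-3.12** (the located clause of the lead's HEAD WORD Q-F-57-2:
«print's ‹Fourier transform of› = the Plancherel–Poisson dictionary STATED in the file header [of `LandauPenaltyFibre`], NOT a
kernel theorem — identification OWED at row F1.Eq3.13-3.15, member M′») and **F1.Eq3.13-3.15** (where M′ is housed).  This file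
IS member M′.  HOME `run/shared/lean/pub/lit-balaban/`.

WHAT PRINT SAYS (p. 327–328).  «We thus have prescribed (χ_p, A) = β_p, p ∈ ℒ⁰. (3.3)  We seek a minimum of the action S, for
a Landau gauge A′ … S = ½∫Σ_{i,j}(∂A′_i/∂x_j)² + ½α² Σ_{p∈ℒ⁰} ((χ_p, A′) − β_p)², (3.4) and then take the limit α → ∞. … We let
D be the differential-integral operator D = −Δ + α² Σ_γ χ_γχ_γ. (3.5)  The sum over γ is understood to be over plaquettes in ℒ⁰.
We now exhibit the Fourier transform of C = D⁻¹, C(p, p′) = (1/p²)δ(p − p′) − Σ_n (2π)⁴ (1/p²) P̃(p) [α²/(1 + α²M(p))] P̃̄(p′)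
(1/p′²) δ(p − p′ − 2πn), (3.6) … (3.7) … If a is the pair of axes, i and j, then P̃_a is the Fourier transform of the function
[A(x_i,x_j) i_i + B(x_i,x_j) i_j]·χ₀^{i,j}, (3.8) … (3.9) We have taken an arbitrary fixed orientation of the axes to get this
expression. … P̃_a(p) = (1/2π)² (…) (3.10)».

THE DICTIONARY, AND WHAT IS PROVED (kernel-checked; `def`s with bodies; 0 `Prop`-valued definitions, 0 named facts, 0 `sorry`).
`LandauPenaltyFibre` (r17 g57) typed (3.4)–(3.6) twice — in position space (`LandauPenalty.penaltyAction`, `opDPos`) and on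
the momentum fibre `{p + 2πn}` (`PlaquetteGram.penS`, `opD`, `opC`) — proved `C = D⁻¹` and (3.4) ⇒ (3.11) on every fibre, and
STATED the identification of the two sides as a dictionary.  Here the dictionary is made a theorem, on the core of smooth
compactly supported vector fields `A ∈ C_c^∞(ℝ⁴; ℝ⁴)` (and finitely supported plaquette data `β`), in print's transform
convention `Ã_μ(k) = (1/2π)² ∫ e^{−ik·x} A_μ(x) d⁴x` (`ftil`; the `(1/2π)²` of (3.10)), `Ã|_p(n) = Ã(p + 2πn)` (`fib`),
`β̂_a(p) = Σ_b e^{−ip·b} β_{⟨b,a⟩}` (`betaHat`):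
* §1 `integral_norm_sq_hatE` — PLANCHEREL in the tree's kernel convention, `∫|ȟ|² d⁴k = (2π)⁴∫|g|² d⁴x` (Mathlib's
  `SchwartzMap.integral_norm_sq_fourier` after `k = −2πw`); the FULL Poisson summation formula is the tree's
  `LandauModeBondMultipliers.perSum_hatE_eq_sum` (r17 g12).
* §2 **D1, Poisson summation over the plaquette corners** (`pairing_fib_eq_sum`, `pairing_fib_eq_tsum`): for every real
  `p ∉ 2πℤ⁴` (coordinatewise) and every axis pair `a`, `⟨a, Ã|_p⟩ := (2π)⁴ Σ_n P̄̃_a(p+2πn)·Ã(p+2πn) = Σ_{b∈ℤ⁴} e^{−ip·b}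
  (χ_{⟨b,a⟩}, A)` — the fibre pairing of `LandauPenaltyFibre` IS the lattice Fourier series of the level-0 plaquette variables of
  `A` (via `hatE_pairTC`, (3.10) `chiHat_eq_fourierFactor`, `pairT_latPt`); `summable_pairing_fib` (the six pairings converge).
* §3 bookkeeping on the TYPE `Plaq 0` = (corner, axis, axis): `tsum_plaq_eq_two_mul` (a summable function even under
  orientation reversal and zero on degenerate triples sums to TWICE its sum over the geometric plaquettes `⟨b, a⟩`, `a` one of
  the six axis pairs); print's (3.4)/(3.5) with «an arbitrary fixed orientation of the axes» ((3.9)) typed WITH BODIES as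
  `LandauPenalty.penaltyActionFix` / `opDPosFix` (sums over `(b, a) ∈ ℤ⁴ × Fin 6`); the relation to the v3.111 bodies:
  `opDPos_eq_two_mul` / `opDPos_eq_opDPosFix` (`opDPos α = opDPosFix (√2·α)`), `tsum_penalty_eq_two_mul`, and the ERRATUM
  `penaltyAction_eq` / `penaltyAction_eq_zero_of_ne_zero` (below).
* §4 **D2, (3.5) through the dictionary** (`fib_opDPosFix`): `(DA)~|_p(n)_μ = |p+2πn|² Ã_μ(p+2πn) + α² Σ_a P̃_a(p+2πn)_μ
  ⟨a, Ã|_p⟩ = (opD α p (Ã|_p))(n)_μ` for every `α`, real `p ∉ 2πℤ⁴`, `n`, `μ` (the Laplacian by `hatE_pd` twice: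
  `hatE_neg_laplacian`, `fib_neg_laplacian`; the penalty by (3.10) with the phase of (3.12) `hatE_plaqTestField` and D1:
  `fib_penalty`); **D4, «C = D⁻¹» read in position space** (`opC_fib_opDPosFix`): `opC α p ((DA)~|_p) = Ã|_p` (D2 + the fibre
  theorem `opC_opD`); the v3.111 body: `fib_opDPos` (`(opDPos α A)~|_p = opD (√2·α) p (Ã|_p)`).
* §5 **D3, (3.4) through the dictionary** (`penaltyActionFix_eq_integral_penS`, and `…_plaqOfBonds_…` for the plaquette
  variables of finitely supported bond data): `S = ½∫Σ(∂_jA′_i)² + ½α²Σ_{(b,a)}((χ_{⟨b,a⟩}, A′) − β_{⟨b,a⟩})² = ∫_cell penS α p β̂(p)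
  (Ã′|_p) dp` — kinetic term by Plancherel and the decomposition of `ℝ⁴` into translates of the momentum cell
  (`integral_sq_pd_eq`, `integral_kin_eq_cell`, via the tree's `integral_eq_integral_cell_tsum`; decay bookkeeping `kinG`,
  `exists_kinG_le`, `continuous_tsum_kin`), penalty term by D1 and Parseval on the cell for a trigonometric polynomial
  (`integral_cell_normSq_trigPoly`, `tsum_penalty_eq_cell`).

ERRATUM ON `LandauPenaltyFibre` (p361603, r17 g57 — this unit's own lineage; located, recorded as theorems here).
(E1, precedence) The v3.111 position-space body of (3.4), `LandauPenalty.penaltyAction α β A := (1/2) * ∫ x, Σ_{i,j}(∂_jA_i x)² +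
(1/2) * α² * Σ'_q (…)²`, PARSES with the penalty sum INSIDE the `d⁴x` integral (Lean's `∫ x, …` binds weaker than `+`):
`penaltyAction_eq` (`rfl`).  For a smooth compactly supported field, `α ≠ 0` and a non-zero penalty sum the integrand is then a
non-integrable constant offset on `ℝ⁴` and `penaltyAction α β A = 0` (`penaltyAction_eq_zero_of_ne_zero`): that body is NOT
print's `S` except when the penalty vanishes.  (E2, orientation) Both v3.111 position-space bodies sum over the TYPE `Plaq 0`,
which carries BOTH orientations `⟨b,i,j⟩`, `⟨b,j,i⟩` of every plaquette (and the degenerate `⟨b,i,i⟩`, contributing `0`),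
whereas print sums over `p ∈ ℒ⁰` with ONE fixed orientation ((3.9)): `opDPos α = opDPosFix (√2·α)` (`opDPos_eq_two_mul`),
`Σ_{q : Plaq 0}(…)² = 2 Σ_{(b,a)}(…)²` (`tsum_penalty_eq_two_mul`).  The factor is immaterial under print's `α → ∞`, and every
fibre theorem of `LandauPenaltyFibre` (`opD_opC`, `opC_opD`, `opC_src`, `opD_eq_src_of_isMin`, …; `penS`, whose `∑'`/`∑` DO
bind tighter than `+`) is unaffected.  The verbatim position-space displays are `penaltyActionFix` / `opDPosFix` of this file,
for which D2–D4 hold at the SAME `α`.  (Def bodies are append-only; the v3.111 names are kept, annotated here.)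

HONEST SCOPE.  (a) The dictionary is proved on the CORE `A ∈ C_c^∞(ℝ⁴; ℝ⁴)` (smooth, compactly supported), `β` finitely
supported (print's β: the level-0 plaquette variables of a single excitation); the extension to the form/operator domains on
which print's minimiser `A′` lives (closure of the quadratic form (3.4), `D` as a self-adjoint operator) is NOT done here —
D1–D4 identify the two sides on a common core, which is what «the Fourier transform of» asserts between the displayed objects.
(b) Real momenta off the lattice hyperplanes `{p_k ∈ 2πℤ}` (a null set; the fibre objects of `LandauPenaltyFibre` use
`fourierFactor`, which carries the removable singularities of (3.10) as junk values there); D3 is an identity of integrals and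
unaffected.  (c) Existence/uniqueness of print's minimiser and the limit `α → ∞` are not touched (see `LandauModeFormula`,
`ConstrainedMinimality`).  (d) No `Prop`-valued definition, no named fact (D-0026); axioms standard.
-/

namespace Literature.MathematicalPhysics.QuantumFieldTheory.Federbush1986

noncomputable section

open Complex ModeAnalyticity Filter Topology MeasureTheory Set
open scoped BigOperators ComplexConjugate FourierTransform ContDiff

namespace PlaquetteGram

open ModeDecay (toC)

/-! ## §0 Print's transform convention and the fibre restriction -/

/-- Print's Fourier transform of a component of a vector field in the symmetric convention of (3.10) («P̃_a(p) = (1/2π)² …»):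
`Ã_μ(k) = (1/2π)² ∫ e^{−ik·x} A_μ(x) d⁴x`. [cite: Federbush1986PhaseCellI, (3.6) p. 327, (3.10) p. 328] -/
def ftil (A : E4 → Fin 4 → ℝ) (μ : Fin 4) (k : Fin 4 → ℝ) : ℂ :=
  (1 / (2 * Real.pi) ^ 2 : ℂ) * ∫ x : E4, cexp (-I * ∑ j, (k j : ℂ) * ((x j : ℝ) : ℂ)) * ((A x μ : ℝ) : ℂ)

/-- The restriction of `Ã` to the momentum fibre `{p + 2πn : n ∈ ℤ⁴}` over `p` (the fibre functions of `LandauPenaltyFibre`):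
`(Ã|_p)(n)_μ = Ã_μ(p + 2πn)`. [cite: Federbush1986PhaseCellI, (3.6) p. 327] -/
def fib (A : E4 → Fin 4 → ℝ) (p : Fin 4 → ℝ) : Fib := fun n μ => ftil A μ (shiftR p n)

/-- The lattice Fourier series of level-0 plaquette data along the six axis pairs: `β̂_a(p) = Σ_{b∈ℤ⁴} e^{−ip·b} β_{⟨b,a⟩}`.
[cite: Federbush1986PhaseCellI, (3.11)–(3.12) p. 328] -/
def betaHat (β : Plaq 0 → ℝ) (p : Fin 4 → ℝ) (a : Fin 6) : ℂ :=
  ∑' b : Fin 4 → ℤ, cexp (-I * ∑ k, (p k : ℂ) * (b k : ℂ)) * ((β (plaqAt b a) : ℝ) : ℂ)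

/-- `Ã_μ(k) = (1/2π)² conj Ψ_μ(k)` for a real field (`Ψ_μ = tfT A μ`, kernel `e^{+ik·x}`). [cite: Federbush1986PhaseCellI, (3.6) p. 327] -/
theorem ftil_eq (A : E4 → Fin 4 → ℝ) (μ : Fin 4) (k : Fin 4 → ℝ) :
    ftil A μ k = (1 / (2 * Real.pi) ^ 2 : ℂ) * conj (tfT A μ k) := by
  unfold ftil tfT hatE cpt
  congr 1
  rw [← integral_conj]
  refine integral_congr_ae (ae_of_all _ fun y => ?_)
  simp only [map_mul, Complex.conj_ofReal, ← Complex.exp_conj, map_sum, Complex.conj_I]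

/-- Unfolding the fibre restriction. [cite: Federbush1986PhaseCellI, (3.6) p. 327] -/
theorem fib_apply (A : E4 → Fin 4 → ℝ) (p : Fin 4 → ℝ) (n : Fin 4 → ℤ) (μ : Fin 4) :
    fib A p n μ = (1 / (2 * Real.pi) ^ 2 : ℂ) * conj (tfT A μ (shiftR p n)) := ftil_eq A μ _

/-! ## §1 Tools: integrability on the momentum cell, Plancherel in the tree's kernel convention (the full Poisson summation formula is `LandauModeBondMultipliers.perSum_hatE_eq_sum`) -/

/-- A continuous function on momentum space (any complete normed codomain) is integrable on the cell (cf. the `ℂ`-valued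
`integrableOn_cell_of_continuous` of `LandauModeBondMultipliers`). [cite: FederbushWilliamson1987PhaseCellII, (3.1) p. 1417] -/
theorem integrableOn_cell_of_continuous' {F : Type*} [NormedAddCommGroup F] {G : (Fin 4 → ℝ) → F} (hG : Continuous G) :
    IntegrableOn G cell :=
  (hG.continuousOn.integrableOn_compact isCompact_Icc).mono_set cell_subset_Icc

/-- Change of variables `p ↦ c·p ∈ ℝ⁴ = E4`: `∫ F(c·p) d⁴p = |c|⁻⁴ ∫_{E4} F`. [folklore] -/
private theorem integral_comp_smul_toE4' {F : Type*} [NormedAddCommGroup F] [NormedSpace ℝ F] (G : E4 → F) (c : ℝ) :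
    ∫ p : Fin 4 → ℝ, G (c • toE4 p) = |(c ^ 4)⁻¹| • ∫ w : E4, G w := by
  have h1 : ∫ p : Fin 4 → ℝ, G (c • toE4 p) = ∫ w : E4, G (c • w) := by
    rw [← (PiLp.volume_preserving_toLp (Fin 4)).integral_comp (MeasurableEquiv.toLp 2 (Fin 4 → ℝ)).measurableEmbedding]
  rw [h1, Measure.integral_comp_smul volume G c]
  simp [finrank_euclideanSpace]

/-- **Plancherel in the tree's kernel convention**: for a smooth compactly supported `g` on `ℝ⁴`,
`∫ |ȟ(k)|² d⁴k = (2π)⁴ ∫ |g(x)|² d⁴x` (`ȟ(k) = ∫ e^{ik·x} g`; Mathlib's Plancherel theorem for Schwartz functions after the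
substitution `k = −2πw`). [cite: SteinWeiss1971, Ch. I Thm 2.1; Federbush1986PhaseCellI, (3.4)–(3.6) p. 327] -/
theorem integral_norm_sq_hatE {g : E4 → ℂ} (hg : ContDiff ℝ ∞ g) (hs : HasCompactSupport g) :
    ∫ k : Fin 4 → ℝ, ‖hatE g k‖ ^ 2 = (2 * Real.pi) ^ 4 * ∫ x, ‖g x‖ ^ 2 := by
  have h1 : (fun k : Fin 4 → ℝ => ‖hatE g k‖ ^ 2)
      = fun k => (fun w : E4 => ‖𝓕 g w‖ ^ 2) ((-(1 / (2 * Real.pi)) : ℝ) • toE4 k) := by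
    funext k; simp only [hatE_eq_fourier]
  rw [h1, integral_comp_smul_toE4' (fun w : E4 => ‖𝓕 g w‖ ^ 2)]
  have hP : ∫ w : E4, ‖𝓕 g w‖ ^ 2 = ∫ x, ‖g x‖ ^ 2 := by
    have := SchwartzMap.integral_norm_sq_fourier (hs.toSchwartzMap hg)
    rw [SchwartzMap.fourier_coe] at this
    exact this
  rw [hP, smul_eq_mul]
  congr 1
  rw [show (-(1 / (2 * Real.pi)) : ℝ) ^ 4 = ((2 * Real.pi) ^ 4)⁻¹ by ring, inv_inv, abs_of_pos (by positivity)]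

/-! ## §2 Poisson summation over the plaquette corners: `Σ_b e^{−ip·b}(χ_{⟨b,a⟩}, A)` IS the fibre pairing `⟨a, Ã|_p⟩` -/

variable {A : E4 → Fin 4 → ℝ}

/-- `|m_k| ≤ ‖m‖` for a lattice point viewed in `ℝ⁴`. [folklore] -/
private theorem abs_le_norm_latPt (m : Fin 4 → ℤ) (k : Fin 4) : |(m k : ℝ)| ≤ ‖latPt m‖ := by
  have h := PiLp.norm_apply_le (latPt m) k
  rw [Real.norm_eq_abs] at h
  exact h

/-- The lattice points of sup-norm at most `N` form a finite set. [folklore] -/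
private theorem finite_latBox (N : ℤ) : Set.Finite {m : Fin 4 → ℤ | ∀ k, |m k| ≤ N} := by
  have h : {m : Fin 4 → ℤ | ∀ k, |m k| ≤ N} ⊆ Set.univ.pi fun _ : Fin 4 => Set.Icc (-N) N := by
    intro m hm
    simp only [Set.mem_pi, Set.mem_univ, true_implies, Set.mem_Icc]
    exact fun k => abs_le.mp (hm k)
  exact (Set.Finite.pi fun _ => Set.finite_Icc (-N) N).subset h

/-- **A compactly supported field has only finitely many non-zero level-0 plaquette pairings**: there is a finite set of
corners `S ⊂ ℤ⁴` outside which every translated pairing `h_a(m) = (χ_{⟨m,a⟩}, A)` vanishes.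
[cite: Federbush1986PhaseCellI, (3.3) p. 327, (3.9) p. 328] -/
theorem exists_finset_pairT_eq_zero (hsupp : HasCompactSupport A) :
    ∃ S : Finset (Fin 4 → ℤ), ∀ a, ∀ m ∉ S, pairT A a (latPt m) = 0 := by
  have hR : ∀ a : Fin 6, ∃ R : ℝ, ∀ y : E4, R < ‖y‖ → pairT A a y = 0 := by
    intro a
    obtain ⟨R, hR⟩ := (hasCompactSupport_pairT hsupp a).isCompact.isBounded.subset_closedBall 0
    refine ⟨R, fun y hy => image_eq_zero_of_notMem_tsupport fun hmem => ?_⟩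
    have := hR hmem
    rw [Metric.mem_closedBall, dist_zero_right] at this
    linarith
  choose R hR using hR
  obtain ⟨N, hN⟩ := exists_nat_ge (∑ a, |R a|)
  refine ⟨(finite_latBox N).toFinset, fun a m hm => hR a _ ?_⟩
  rw [Set.Finite.mem_toFinset] at hm
  simp only [Set.mem_setOf_eq, not_forall, not_le] at hm
  obtain ⟨k, hk⟩ := hm
  have h1 : R a ≤ ∑ a, |R a| := (le_abs_self _).trans (Finset.single_le_sum (fun a _ => abs_nonneg (R a)) (Finset.mem_univ a))
  have h2 : ((N : ℤ) : ℝ) < |(m k : ℝ)| := by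
    rw [← Int.cast_abs]; exact_mod_cast hk
  have h3 : ((N : ℤ) : ℝ) = (N : ℝ) := by simp
  linarith [abs_le_norm_latPt m k]

/-- `conj (1/(2π)²) = 1/(2π)²`. [folklore] -/
private theorem conj_invTwoPiSq' : conj (1 / (2 * Real.pi) ^ 2 : ℂ) = (1 / (2 * Real.pi) ^ 2 : ℂ) := by
  have : (1 / (2 * Real.pi) ^ 2 : ℂ) = ((1 / (2 * Real.pi) ^ 2 : ℝ) : ℂ) := by push_cast; rfl
  rw [this, Complex.conj_ofReal]

/-- `conj e^{ip·m} = e^{−ip·m}` for real `p`, integer `m`. [folklore] -/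
private theorem conj_cexp_phase (p : Fin 4 → ℝ) (m : Fin 4 → ℤ) :
    conj (cexp (I * ∑ k, (p k : ℂ) * (m k : ℂ))) = cexp (-I * ∑ k, (p k : ℂ) * (m k : ℂ)) := by
  rw [← Complex.exp_conj]
  congr 1
  simp only [map_mul, Complex.conj_I, map_sum, Complex.conj_ofReal, neg_mul]
  congr 2
  exact Finset.sum_congr rfl fun k _ => by rw [← Complex.ofReal_intCast, Complex.conj_ofReal]

/-- **Poisson summation over the plaquette corners (finite form).** For a smooth compactly supported field `A`, a real
momentum `p ∉ 2πℤ⁴` (coordinatewise), an axis pair `a`, and any finite set of corners `S` carrying all non-zero pairings: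
`⟨a, Ã|_p⟩ = (2π)⁴ Σ_n P̄̃_a(p+2πn)·Ã(p+2πn) = Σ_{b∈S} e^{−ip·b} (χ_{⟨b,a⟩}, A)` — the fibre pairing of `LandauPenaltyFibre` IS the
lattice Fourier series of the level-0 plaquette variables of `A` (the `χ_γ(χ_γ, ·)` of (3.5) summed over the corners, seen in
momentum space: (3.6)–(3.7) «Σ_n … δ(p − p′ − 2πn)»). [cite: Federbush1986PhaseCellI, (3.5)–(3.7) p. 327, (3.10) p. 328; SteinWeiss1971, Ch. VII §2 Thm 2.4] -/
theorem pairing_fib_eq_sum (hA : ContDiff ℝ ∞ A) (hsupp : HasCompactSupport A) {p : Fin 4 → ℝ}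
    (hp : ∀ k (m : ℤ), p k ≠ 2 * Real.pi * m) (a : Fin 6) (S : Finset (Fin 4 → ℤ))
    (hS : ∀ m ∉ S, pairT A a (latPt m) = 0) :
    pairing p a (fib A p) = ∑ m ∈ S, cexp (-I * ∑ k, (p k : ℂ) * (m k : ℂ)) * ((plaqFunctional 0 A (plaqAt m a) : ℝ) : ℂ) := by
  obtain ⟨C, hdec⟩ := invSqDecay_hatE_pairTC hA hsupp a
  have hcont := hA.continuous
  have hS' : ∀ m ∉ S, pairTC A a (latPt m) = 0 := fun m hm => by simp [pairTC, hS m hm]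
  have hP := perSum_hatE_eq_sum (continuous_pairTC hcont hsupp a) (integrable_pairTC hcont hsupp a) hdec S hS' p
  have hPc : conj (perSum (hatE (pairTC A a)) p)
      = ∑ m ∈ S, cexp (-I * ∑ k, (p k : ℂ) * (m k : ℂ)) * ((plaqFunctional 0 A (plaqAt m a) : ℝ) : ℂ) := by
    rw [hP, map_sum]
    refine Finset.sum_congr rfl fun m _ => ?_
    rw [map_mul, conj_cexp_phase, pairTC]
    rw [Complex.conj_ofReal, show (toE4 fun k => (m k : ℝ)) = latPt m from rfl, pairT_latPt hcont, mul_comm]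
  rw [← hPc]
  unfold perSum pairing
  rw [Complex.conj_tsum, ← tsum_mul_left]
  refine tsum_congr fun n => ?_
  have hq : ∀ k, shiftR p n k ≠ 0 := fun k => shiftR_ne_zero (hp k) n
  rw [hatE_pairTC hA hsupp a, map_sum, Finset.mul_sum]
  refine Finset.sum_congr rfl fun μ _ => ?_
  rw [map_mul, chiHat_eq_fourierFactor a μ hq, fib_apply, Ptil, map_mul, conj_invTwoPiSq']
  have h2 : (2 * Real.pi : ℂ) ≠ 0 := by exact_mod_cast (by positivity : (2 * Real.pi : ℝ) ≠ 0)
  field_simp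

/-- **Poisson summation over the plaquette corners**: `⟨a, Ã|_p⟩ = Σ_{b∈ℤ⁴} e^{−ip·b} (χ_{⟨b,a⟩}, A)` for every smooth compactly
supported field, every real `p ∉ 2πℤ⁴`, every axis pair. [cite: Federbush1986PhaseCellI, (3.5)–(3.7) p. 327; SteinWeiss1971, Ch. VII §2 Thm 2.4] -/
theorem pairing_fib_eq_tsum (hA : ContDiff ℝ ∞ A) (hsupp : HasCompactSupport A) {p : Fin 4 → ℝ}
    (hp : ∀ k (m : ℤ), p k ≠ 2 * Real.pi * m) (a : Fin 6) :
    pairing p a (fib A p)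
      = ∑' m : Fin 4 → ℤ, cexp (-I * ∑ k, (p k : ℂ) * (m k : ℂ)) * ((plaqFunctional 0 A (plaqAt m a) : ℝ) : ℂ) := by
  obtain ⟨S, hS⟩ := exists_finset_pairT_eq_zero hsupp
  rw [pairing_fib_eq_sum hA hsupp hp a S (hS a), tsum_eq_sum]
  intro m hm
  rw [← pairT_latPt hA.continuous, hS a m hm]
  simp

/-- The six fibre pairings of `Ã|_p` converge (the summability hypothesis of `opC_opD` / `opD_opC`).
[cite: FederbushWilliamson1987PhaseCellII, (1.4) p. 1416, (6.8) p. 1418] -/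
theorem summable_pairing_fib (hA : ContDiff ℝ ∞ A) (hsupp : HasCompactSupport A) {p : Fin 4 → ℝ}
    (hp : ∀ k (m : ℤ), p k ≠ 2 * Real.pi * m) (a : Fin 6) :
    Summable fun n : Fin 4 → ℤ => ∑ μ, conj (Ptil a (shiftR p n) μ) * fib A p n μ := by
  have hs := ((summable_plaqSide_shiftR hA hsupp a hp).mul_left (1 / (2 * Real.pi) ^ 4 : ℂ)).star
  have hc : conj (1 / (2 * Real.pi) ^ 4 : ℂ) = (1 / (2 * Real.pi) ^ 4 : ℂ) := by
    have : (1 / (2 * Real.pi) ^ 4 : ℂ) = ((1 / (2 * Real.pi) ^ 4 : ℝ) : ℂ) := by push_cast; rfl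
    rw [this, Complex.conj_ofReal]
  refine hs.congr fun n => ?_
  simp only [Complex.star_def, map_mul, plaqSide, map_sum, Finset.mul_sum, fib_apply, Ptil, conj_invTwoPiSq', hc]
  refine Finset.sum_congr rfl fun μ _ => ?_
  ring


/-! ## §3 Bookkeeping on the TYPE `Plaq 0`: geometric plaquettes `⟨b, a⟩` (one fixed orientation, (3.9)) versus all triples -/

/-- `Plaq 0` is the type of triples (corner, first axis, second axis). [cite: Federbush1986PhaseCellI, Fig. 4 p. 324] -/
def plaqEquiv : Plaq 0 ≃ (Fin 4 → ℤ) × Fin 4 × Fin 4 where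
  toFun q := (q.base, q.dir₁, q.dir₂)
  invFun t := ⟨t.1, t.2.1, t.2.2⟩
  left_inv q := by cases q; rfl
  right_inv t := rfl

/-- `(b, a) ↦ ⟨b, a⟩` is injective (the six axis pairs are distinct). [cite: FederbushWilliamson1987PhaseCellII, (1.1) p. 1416] -/
theorem plaqAt_injective : Function.Injective fun ba : (Fin 4 → ℤ) × Fin 6 => plaqAt ba.1 ba.2 := by
  rintro ⟨b, a⟩ ⟨b', a'⟩ h
  simp only [plaqAt, Plaq.mk.injEq] at h
  obtain ⟨hb, h1, h2⟩ := h
  have ha : a = a' := by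
    have hp : axisPair a = axisPair a' := Prod.ext h1 h2
    revert hp; revert a a'; decide
  subst hb; subst ha; rfl

/-- Over one corner, a function of the ordered axis pair that is EVEN under reversal and ZERO on the diagonal sums to twice its
sum over the six axis pairs. [cite: FederbushWilliamson1987PhaseCellII, (1.1) p. 1416] -/
theorem sum_dirs_eq_two_mul_sum_axisPair (G : Fin 4 → Fin 4 → ℝ) (hswap : ∀ i j, G j i = G i j) (hself : ∀ i, G i i = 0) :
    ∑ i, ∑ j, G i j = 2 * ∑ a : Fin 6, G (axisPair a).1 (axisPair a).2 := by
  simp only [Fin.sum_univ_four, Fin.sum_univ_six]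
  simp [axisPair]
  rw [hself 0, hself 1, hself 2, hself 3, hswap 0 1, hswap 0 2, hswap 0 3, hswap 1 2, hswap 1 3, hswap 2 3]
  ring

/-- **A summable function on the type `Plaq 0` that is even under orientation reversal and vanishes on degenerate triples sums
to TWICE its sum over the geometric plaquettes `⟨b, a⟩`** (`b ∈ ℤ⁴`, `a` one of the six axis pairs `i < j`): the type carries
both orientations of every plaquette. [cite: Federbush1986PhaseCellI, (3.9) p. 328 («We have taken an arbitrary fixed orientation of the axes»)] -/
theorem tsum_plaq_eq_two_mul (F : Plaq 0 → ℝ) (hF : Summable F)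
    (hswap : ∀ b i j, F ⟨b, j, i⟩ = F ⟨b, i, j⟩) (hself : ∀ b i, F ⟨b, i, i⟩ = 0) :
    ∑' q, F q = 2 * ∑' ba : (Fin 4 → ℤ) × Fin 6, F (plaqAt ba.1 ba.2) := by
  have h1 : ∑' q, F q = ∑' t : (Fin 4 → ℤ) × (Fin 4 × Fin 4), F (plaqEquiv.symm t) :=
    (plaqEquiv.symm.tsum_eq F).symm
  have hF' : Summable fun t : (Fin 4 → ℤ) × (Fin 4 × Fin 4) => F (plaqEquiv.symm t) :=
    plaqEquiv.symm.summable_iff.mpr hF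
  have hG : Summable fun ba : (Fin 4 → ℤ) × Fin 6 => F (plaqAt ba.1 ba.2) := hF.comp_injective plaqAt_injective
  rw [h1, hF'.tsum_prod' fun b => (hasSum_fintype _).summable, hG.tsum_prod' fun b => (hasSum_fintype _).summable,
    ← tsum_mul_left]
  refine tsum_congr fun b => ?_
  rw [tsum_fintype, tsum_fintype, Fintype.sum_prod_type]
  exact sum_dirs_eq_two_mul_sum_axisPair (fun i j => F ⟨b, i, j⟩) (fun i j => hswap b i j) (fun i => hself b i)

/-- At a point `x`, only the plaquettes with corner in a finite box have `χ_q(x) ≠ 0`. [cite: Federbush1986PhaseCellI, (3.9) p. 328] -/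
theorem exists_finset_plaqTestField_eq_zero (x : E4) :
    ∃ B : Finset (Fin 4 → ℤ), ∀ q : Plaq 0, q.base ∉ B → ∀ μ, plaqTestField q x μ = 0 := by
  obtain ⟨N, hN⟩ := exists_nat_ge (∑ k, |x k| + 2)
  refine ⟨(finite_latBox N).toFinset, fun q hq μ => plaqTestField_eq_zero_of_not_mem q (fun hmem => hq ?_) μ⟩
  rw [Set.Finite.mem_toFinset]
  intro k
  have h1 := hmem.1 k
  have h2 := hmem.2 k
  simp only [cubeCoord_apply, latLen, pow_zero, inv_one, one_mul, Plaq.src, mkPt, Pi.ofNat_apply] at h1 h2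
  have h1' : (q.base k : ℝ) ≤ x k := by
    have : (0 : ℝ) ≤ x k - q.base k := by simpa using h1
    linarith
  have h2' : x k - 2 ≤ (q.base k : ℝ) := by
    have : x k - (q.base k : ℝ) ≤ 2 := by simpa using h2
    linarith
  have hxk : |x k| + 2 ≤ N := le_trans (by
    have := Finset.single_le_sum (f := fun k => |x k|) (fun k _ => abs_nonneg (x k)) (Finset.mem_univ k)
    simpa using this) (by linarith [hN] : ∑ k, |x k| + 2 ≤ (N : ℝ))
  have : |(q.base k : ℝ)| ≤ N := by
    rw [abs_le]; constructor <;> [linarith [neg_abs_le (x k)]; linarith [le_abs_self (x k)]]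
  exact_mod_cast this

/-- A compactly supported continuous field has `(χ_q, A) = 0` for every triple `q` with corner outside a finite set carrying
the axis-pair pairings. [cite: Federbush1986PhaseCellI, (3.3) p. 327] -/
theorem plaqFunctional_eq_zero_of_base (hcont : Continuous A) {S : Finset (Fin 4 → ℤ)}
    (hS : ∀ a, ∀ m ∉ S, pairT A a (latPt m) = 0) (q : Plaq 0) (hq : q.base ∉ S) : plaqFunctional 0 A q = 0 := by
  obtain ⟨b, i, j⟩ := q
  by_cases hij : i = j
  · subst hij; exact plaqFunctional_self hcont b i
  obtain ⟨a, ha | ha⟩ := exists_axisPair hij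
  · have : (⟨b, i, j⟩ : Plaq 0) = plaqAt b a := by simp [plaqAt, ha]
    rw [this, ← pairT_latPt hcont, hS a b hq]
  · have : (⟨b, j, i⟩ : Plaq 0) = plaqAt b a := by simp [plaqAt, ha]
    rw [plaqFunctional_swap hcont b j i, this, ← pairT_latPt hcont, hS a b hq, neg_zero]

/-- The finite set of triples with corner in `B`. [cite: Federbush1986PhaseCellI, Fig. 4 p. 324] -/
def plaqsOver (B : Finset (Fin 4 → ℤ)) : Finset (Plaq 0) :=
  (B ×ˢ (Finset.univ : Finset (Fin 4 × Fin 4))).map plaqEquiv.symm.toEmbedding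

/-- Membership in `plaqsOver B` is membership of the corner in `B`. [cite: Federbush1986PhaseCellI, Fig. 4 p. 324] -/
theorem mem_plaqsOver {B : Finset (Fin 4 → ℤ)} {q : Plaq 0} : q ∈ plaqsOver B ↔ q.base ∈ B := by
  rw [plaqsOver, Finset.mem_map_equiv]
  simp [plaqEquiv]

end PlaquetteGram

namespace LandauPenalty

open PlaquetteGram

/-- **(3.5) as printed, with print's orientation convention**: «D = −Δ + α² Σ_γ χ_γχ_γ. The sum over γ is understood to be over
plaquettes in ℒ⁰» with «an arbitrary fixed orientation of the axes» ((3.9)): the sum runs over the GEOMETRIC level-0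
plaquettes `γ = ⟨b, a⟩`, `b ∈ ℤ⁴`, `a` one of the six axis pairs — `(DA)_μ(x) = −Σ_j ∂_j∂_j A_μ(x) + α² Σ_{(b,a)} χ_{⟨b,a⟩}(x)_μ
(χ_{⟨b,a⟩}, A)`.  (The v3.111 body `opDPos` sums over the TYPE `Plaq 0`, i.e. over both orientations of each plaquette:
`opDPos_eq_opDPosFix`.) [cite: Federbush1986PhaseCellI, (3.5) p. 327, (3.9) p. 328] -/
def opDPosFix (α : ℝ) (A : E4 → Fin 4 → ℝ) (x : E4) (μ : Fin 4) : ℝ :=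
  -(∑ j, pd (fun y ν => pd A j ν y) j μ x)
    + α ^ 2 * ∑' ba : (Fin 4 → ℤ) × Fin 6, plaqTestField (plaqAt ba.1 ba.2) x μ * plaqFunctional 0 A (plaqAt ba.1 ba.2)

/-- **(3.4) as printed, with print's orientation convention**: «S = ½∫Σ_{i,j}(∂A′_i/∂x_j)² + ½α² Σ_{p∈ℒ⁰} ((χ_p, A′) − β_p)²»,
the sum over the GEOMETRIC level-0 plaquettes `p = ⟨b, a⟩` ((3.9): one fixed orientation per plaquette), the penalty OUTSIDE the
`d⁴x` integral.  (On the v3.111 body `penaltyAction` see the ERRATUM `penaltyAction_eq` / `penaltyAction_eq_zero_of_ne_zero`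
below.) [cite: Federbush1986PhaseCellI, (3.4) p. 327, (3.9) p. 328] -/
def penaltyActionFix (α : ℝ) (β : Plaq 0 → ℝ) (A : E4 → Fin 4 → ℝ) : ℝ :=
  (1 / 2) * (∫ x, ∑ i, ∑ j, (pd A j i x) ^ 2)
    + (1 / 2) * α ^ 2 * ∑' ba : (Fin 4 → ℤ) × Fin 6, (plaqFunctional 0 A (plaqAt ba.1 ba.2) - β (plaqAt ba.1 ba.2)) ^ 2

variable {A : E4 → Fin 4 → ℝ}

/-- **The v3.111 body of (3.5) counts every plaquette with both orientations**: for a continuous field,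
`opDPos α A = −ΔA + 2α² Σ_{(b,a)} χ_{⟨b,a⟩}(χ_{⟨b,a⟩}, A)` (degenerate triples contribute `0`, reversed triples the same term:
`χ_{⟨b,j,i⟩} = −χ_{⟨b,i,j⟩}`), i.e. `opDPos α = opDPosFix (√2·α)`.  Immaterial for print's `α → ∞`, but the literal match with
the fibre operator `opD α` of `LandauPenaltyFibre` is `opDPosFix α` (`PlaquetteGram.fib_opDPosFix`). [cite: Federbush1986PhaseCellI, (3.5) p. 327, (3.9) p. 328] -/
theorem opDPos_eq_two_mul (hcont : Continuous A) (α : ℝ) (x : E4) (μ : Fin 4) :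
    opDPos α A x μ = -(∑ j, pd (fun y ν => pd A j ν y) j μ x)
      + 2 * α ^ 2 * ∑' ba : (Fin 4 → ℤ) × Fin 6, plaqTestField (plaqAt ba.1 ba.2) x μ * plaqFunctional 0 A (plaqAt ba.1 ba.2) := by
  obtain ⟨B, hB⟩ := exists_finset_plaqTestField_eq_zero x
  have hsum : Summable fun q : Plaq 0 => plaqTestField q x μ * plaqFunctional 0 A q := by
    refine summable_of_ne_finset_zero (s := plaqsOver B) fun q hq => ?_
    rw [hB q (fun h => hq (mem_plaqsOver.mpr h)) μ, zero_mul]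
  rw [opDPos, tsum_plaq_eq_two_mul _ hsum (fun b i j => ?_) (fun b i => ?_)]
  · ring
  · rw [plaqTestField_swap, plaqFunctional_swap hcont]; ring
  · rw [plaqTestField_self, zero_mul]

/-- `opDPos α A = opDPosFix (√2·α) A` for continuous `A`. [cite: Federbush1986PhaseCellI, (3.5) p. 327, (3.9) p. 328] -/
theorem opDPos_eq_opDPosFix (hcont : Continuous A) (α : ℝ) (x : E4) (μ : Fin 4) :
    opDPos α A x μ = opDPosFix (Real.sqrt 2 * α) A x μ := by
  rw [opDPos_eq_two_mul hcont, opDPosFix, mul_pow, Real.sq_sqrt (by norm_num : (0 : ℝ) ≤ 2)]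

/-- **Orientation bookkeeping for the penalty sum**: over the TYPE `Plaq 0`, for a continuous compactly supported field and
plaquette data `β` that are ODD under orientation reversal, ZERO on degenerate triples and finitely supported (e.g. the plaquette
variables `plaqOfBonds` of finitely supported bond data), `Σ_{q : Plaq 0} ((χ_q, A) − β_q)² = 2 Σ_{(b,a)} ((χ_{⟨b,a⟩}, A) − β_{⟨b,a⟩})²`.
[cite: Federbush1986PhaseCellI, (3.4) p. 327, (3.9) p. 328] -/
theorem tsum_penalty_eq_two_mul (hcont : Continuous A) (hsupp : HasCompactSupport A) {β : Plaq 0 → ℝ}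
    (hβswap : ∀ b i j, β ⟨b, j, i⟩ = -β ⟨b, i, j⟩) (hβself : ∀ b i, β ⟨b, i, i⟩ = 0)
    (hβfin : ∃ B : Finset (Fin 4 → ℤ), ∀ q : Plaq 0, q.base ∉ B → β q = 0) :
    ∑' q : Plaq 0, (plaqFunctional 0 A q - β q) ^ 2
      = 2 * ∑' ba : (Fin 4 → ℤ) × Fin 6, (plaqFunctional 0 A (plaqAt ba.1 ba.2) - β (plaqAt ba.1 ba.2)) ^ 2 := by
  obtain ⟨B, hB⟩ := hβfin
  obtain ⟨S, hS⟩ := exists_finset_pairT_eq_zero hsupp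
  have hsum : Summable fun q : Plaq 0 => (plaqFunctional 0 A q - β q) ^ 2 := by
    refine summable_of_ne_finset_zero (s := plaqsOver (B ∪ S)) fun q hq => ?_
    have hq' : q.base ∉ B ∪ S := fun h => hq (mem_plaqsOver.mpr h)
    rw [Finset.notMem_union] at hq'
    rw [hB q hq'.1, plaqFunctional_eq_zero_of_base hcont hS q hq'.2]; ring
  rw [tsum_plaq_eq_two_mul _ hsum (fun b i j => ?_) (fun b i => ?_)]
  · rw [hβswap, plaqFunctional_swap hcont]; ring
  · rw [hβself, plaqFunctional_self hcont]; ring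

/-- The plaquette variables of bond data are admissible `β`'s: odd, zero on the diagonal. [cite: Federbush1986PhaseCellI, (1.6) p. 322] -/
theorem plaqOfBonds_swap_self (a : Edge 0 → ℝ) :
    (∀ b i j, plaqOfBonds a (⟨b, j, i⟩ : Plaq 0) = -plaqOfBonds a ⟨b, i, j⟩)
      ∧ ∀ b i, plaqOfBonds a (⟨b, i, i⟩ : Plaq 0) = 0 :=
  ⟨fun b i j => plaqOfBonds_swap a b i j, fun b i => plaqOfBonds_self a b i⟩

/-- **ERRATUM on the v3.111 body `penaltyAction` (precedence).** As written, `(1/2) * ∫ x, Σ_{i,j}(∂_jA_i)² + (1/2)α² Σ'_q (…)²`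
parses with the penalty sum INSIDE the `d⁴x` integral: `penaltyAction α β A = ½ ∫ (Σ_{i,j}(∂_jA_i(x))² + ½α² Σ_q ((χ_q, A) − β_q)²) d⁴x`.
The record (`rfl`). [cite: Federbush1986PhaseCellI, (3.4) p. 327] -/
theorem penaltyAction_eq (α : ℝ) (β : Plaq 0 → ℝ) (A : E4 → Fin 4 → ℝ) :
    penaltyAction α β A
      = (1 / 2) * ∫ x, (∑ i, ∑ j, (pd A j i x) ^ 2 + (1 / 2) * α ^ 2 * ∑' q : Plaq 0, (plaqFunctional 0 A q - β q) ^ 2) := rfl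

/-- **ERRATUM, consequence**: for a smooth compactly supported field and a NON-ZERO penalty sum the integrand of the v3.111 body is
a non-integrable constant offset on `ℝ⁴`, so `penaltyAction α β A = 0` (the Bochner integral's value on non-integrable functions) —
it is NOT print's `S`; the verbatim (3.4) is `penaltyActionFix` (and `PlaquetteGram.penaltyActionFix_eq_integral_penS` its
dictionary). [cite: Federbush1986PhaseCellI, (3.4) p. 327] -/
theorem penaltyAction_eq_zero_of_ne_zero (hA : ContDiff ℝ ∞ A) (hsupp : HasCompactSupport A) {α : ℝ} (hα : α ≠ 0)
    {β : Plaq 0 → ℝ} (hpen : ∑' q : Plaq 0, (plaqFunctional 0 A q - β q) ^ 2 ≠ 0) : penaltyAction α β A = 0 := by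
  have hc0 : (1 / 2) * α ^ 2 * ∑' q : Plaq 0, (plaqFunctional 0 A q - β q) ^ 2 ≠ 0 :=
    mul_ne_zero (mul_ne_zero (by norm_num) (pow_ne_zero 2 hα)) hpen
  have hsq : ∀ i j, (fun x : E4 => (pd A j i x) ^ 2) = (fun x => pd A j i x) * (fun x => pd A j i x) := fun i j => by
    funext x; simp [sq]
  have hcs : ∀ i j, HasCompactSupport (fun x : E4 => (pd A j i x) ^ 2) := fun i j => by
    rw [hsq]; exact (hasCompactSupport_pd hsupp j i).mul_left
  have hkin : Integrable fun x : E4 => ∑ i, ∑ j, (pd A j i x) ^ 2 :=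
    integrable_finsetSum _ fun i _ => integrable_finsetSum _ fun j _ =>
      ((continuous_pd hA j i).pow 2).integrable_of_hasCompactSupport (hcs i j)
  have hnot : ¬ Integrable fun x : E4 =>
      ∑ i, ∑ j, (pd A j i x) ^ 2 + (1 / 2) * α ^ 2 * ∑' q : Plaq 0, (plaqFunctional 0 A q - β q) ^ 2 := by
    intro h
    have hconst : Integrable (fun _ : E4 => (1 / 2) * α ^ 2 * ∑' q : Plaq 0, (plaqFunctional 0 A q - β q) ^ 2) := by
      refine (h.sub hkin).congr (ae_of_all _ fun x => ?_)
      simp only [Pi.sub_apply]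
      ring
    rw [integrable_const_iff] at hconst
    rcases hconst with h0 | hfin
    · exact hc0 h0
    · have h1 := measure_univ_of_isAddLeftInvariant (volume : Measure E4)
      have h2 := measure_lt_top (volume : Measure E4) Set.univ
      rw [h1] at h2
      exact lt_irrefl _ h2
  rw [penaltyAction_eq, integral_undef hnot, mul_zero]

end LandauPenalty

namespace PlaquetteGram

open ModeDecay (toC phase)
open LandauPenalty (opDPos opDPosFix penaltyAction penaltyActionFix)

variable {A : E4 → Fin 4 → ℝ}

/-! ## §4 (3.5) through the dictionary: `(DA)~|_p = opD α p (Ã|_p)` -/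

/-- The field of first partials `y ↦ (∂_j A_ν(y))_ν` of a smooth field is smooth. [cite: Federbush1986PhaseCellI, (3.4)–(3.5) p. 327] -/
theorem contDiff_pdField (hA : ContDiff ℝ ∞ A) (j : Fin 4) : ContDiff ℝ ∞ fun y ν => pd A j ν y := by
  refine contDiff_pi.2 fun ν => ?_
  unfold pd
  exact ((contDiff_apply_cpt hA ν).fderiv_right (m := ∞) (by norm_cast)).clm_apply contDiff_const

/-- … and compactly supported if `A` is. [cite: Federbush1986PhaseCellI, (3.4)–(3.5) p. 327] -/
theorem hasCompactSupport_pdField (hsupp : HasCompactSupport A) (j : Fin 4) :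
    HasCompactSupport fun y ν => pd A j ν y := by
  refine hsupp.mono' fun y hy => ?_
  rw [Function.mem_support] at hy
  obtain ⟨ν, hν⟩ : ∃ ν, pd A j ν y ≠ 0 := by
    by_contra h
    push Not at h
    exact hy (funext h)
  have h1 : y ∈ Function.support (fderiv ℝ (fun y => A y ν)) := by
    intro h0
    apply hν
    simp [pd, h0]
  have h2 := support_fderiv_subset ℝ h1
  refine closure_mono (fun z hz => ?_) h2
  rw [Function.mem_support] at hz ⊢
  exact fun h0 => hz (by rw [h0]; rfl)

/-- `ȟ` is additive (integrable summands). [cite: Federbush1986PhaseCellI, (3.6) p. 327] -/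
theorem hatE_add {f g : E4 → ℂ} (hf : Integrable f) (hg : Integrable g) (p : Fin 4 → ℝ) :
    hatE (fun y => f y + g y) p = hatE f p + hatE g p := by
  unfold hatE
  rw [← integral_add (CorrectedMode.integrable_cexp_mul hf p) (CorrectedMode.integrable_cexp_mul hg p)]
  exact integral_congr_ae (ae_of_all _ fun y => by simp only [mul_add])

/-- `ȟ` commutes with scalars. [cite: Federbush1986PhaseCellI, (3.6) p. 327] -/
theorem hatE_const_mul (c : ℂ) (f : E4 → ℂ) (p : Fin 4 → ℝ) : hatE (fun y => c * f y) p = c * hatE f p := by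
  unfold hatE
  rw [← integral_const_mul]
  exact integral_congr_ae (ae_of_all _ fun y => by simp only; ring)

/-- `ȟ` of a negative. [cite: Federbush1986PhaseCellI, (3.6) p. 327] -/
theorem hatE_neg (f : E4 → ℂ) (p : Fin 4 → ℝ) : hatE (fun y => -f y) p = -hatE f p := by
  unfold hatE
  rw [← integral_neg]
  exact integral_congr_ae (ae_of_all _ fun y => by simp only [mul_neg])

/-- `ȟ` of a finite sum (integrable summands). [cite: Federbush1986PhaseCellI, (3.6) p. 327] -/
theorem hatE_finset_sum {ι : Type*} (s : Finset ι) {f : ι → E4 → ℂ} (hf : ∀ i ∈ s, Integrable (f i))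
    (p : Fin 4 → ℝ) : hatE (fun y => ∑ i ∈ s, f i y) p = ∑ i ∈ s, hatE (f i) p := by
  classical
  induction s using Finset.induction_on with
  | empty => simp [hatE]
  | insert i s hi ih =>
    simp_rw [Finset.sum_insert hi]
    rw [hatE_add (hf i (Finset.mem_insert_self i s))
      (integrable_finsetSum _ fun k hk => hf k (Finset.mem_insert_of_mem hk)),
      ih fun k hk => hf k (Finset.mem_insert_of_mem hk)]

/-- **The transform of a translated plaquette test function in the `e^{+ik·x}` kernel**: `∫ e^{ik·x} χ_{⟨b,a⟩}(x)_μ d⁴x =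
e^{ik·b} P̄̃_a(k)_μ` (convention-free factor), all `k_j ≠ 0`. [cite: Federbush1986PhaseCellI, (3.10), (3.12) p. 328] -/
theorem hatE_plaqTestField (b : Fin 4 → ℤ) (a : Fin 6) {k : Fin 4 → ℝ} (hk : ∀ j, k j ≠ 0) (μ : Fin 4) :
    hatE (fun x => ((plaqTestField (plaqAt b a) x μ : ℝ) : ℂ)) k
      = cexp (I * ∑ j, (k j : ℂ) * (b j : ℂ)) * conj (fourierFactor (axisPair a).1 (axisPair a).2 k μ) := by
  rw [← integral_plaqTestField_mul_phase b a hk μ]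
  unfold hatE
  refine integral_congr_ae (ae_of_all _ fun x => ?_)
  dsimp only
  rw [phase_toC_eq_cexp]
  exact mul_comm _ _

/-- **The transform of the Laplacian**: `∫ e^{ik·x} (−Σ_j ∂_j∂_j A_μ)(x) d⁴x = |k|² Ψ_μ(k)`. [cite: Federbush1986PhaseCellI, (3.5) p. 327] -/
theorem hatE_neg_laplacian (hA : ContDiff ℝ ∞ A) (hsupp : HasCompactSupport A) (μ : Fin 4) (k : Fin 4 → ℝ) :
    hatE (fun x => ((-(∑ j, pd (fun y ν => pd A j ν y) j μ x) : ℝ) : ℂ)) k = (∑ j, ((k j : ℝ) : ℂ) ^ 2) * tfT A μ k := by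
  have hint : ∀ j, Integrable fun x => ((pd (fun y ν => pd A j ν y) j μ x : ℝ) : ℂ) := fun j =>
    ((continuous_pd (contDiff_pdField hA j) j μ).integrable_of_hasCompactSupport
      (hasCompactSupport_pd (hasCompactSupport_pdField hsupp j) j μ)).ofReal
  have h1 : (fun x => ((-(∑ j, pd (fun y ν => pd A j ν y) j μ x) : ℝ) : ℂ))
      = fun x => -∑ j ∈ Finset.univ, ((pd (fun y ν => pd A j ν y) j μ x : ℝ) : ℂ) := by
    funext x; push_cast; rfl
  rw [h1, hatE_neg, hatE_finset_sum _ (fun j _ => hint j), ← Finset.sum_neg_distrib, Finset.sum_mul]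
  refine Finset.sum_congr rfl fun j _ => ?_
  rw [hatE_pd (contDiff_pdField hA j) (hasCompactSupport_pdField hsupp j) j μ k]
  have : tfT (fun y ν => pd A j ν y) μ k = -I * (k j : ℂ) * tfT A μ k := by
    rw [tfT, show cpt (fun y ν => pd A j ν y) μ = fun x => ((pd A j μ x : ℝ) : ℂ) from rfl, hatE_pd hA hsupp j μ k]
  rw [this]
  have hI : I * I = -1 := Complex.I_mul_I
  linear_combination (-(k j : ℂ) ^ 2 * tfT A μ k) * hI

/-- The penalty part of `opDPosFix` is a finite sum for a compactly supported field. [cite: Federbush1986PhaseCellI, (3.5) p. 327] -/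
theorem tsum_penalty_eq_sum (hcont : Continuous A) {S : Finset (Fin 4 → ℤ)} (hS : ∀ a, ∀ m ∉ S, pairT A a (latPt m) = 0)
    (x : E4) (μ : Fin 4) :
    ∑' ba : (Fin 4 → ℤ) × Fin 6, plaqTestField (plaqAt ba.1 ba.2) x μ * plaqFunctional 0 A (plaqAt ba.1 ba.2)
      = ∑ ba ∈ S ×ˢ (Finset.univ : Finset (Fin 6)),
          plaqTestField (plaqAt ba.1 ba.2) x μ * plaqFunctional 0 A (plaqAt ba.1 ba.2) := by
  refine tsum_eq_sum fun ba hba => ?_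
  have hb : ba.1 ∉ S := fun h => hba (Finset.mem_product.mpr ⟨h, Finset.mem_univ _⟩)
  rw [← pairT_latPt hcont, hS ba.2 ba.1 hb, mul_zero]

/-- **Linearity of the fibre restriction** (integrable components). [cite: Federbush1986PhaseCellI, (3.5)–(3.6) p. 327] -/
theorem fib_add_const_mul {F G : E4 → Fin 4 → ℝ} (hF : ∀ ν, Integrable fun x => F x ν) (hG : ∀ ν, Integrable fun x => G x ν)
    (c : ℝ) (p : Fin 4 → ℝ) (n : Fin 4 → ℤ) (μ : Fin 4) :
    fib (fun x ν => F x ν + c * G x ν) p n μ = fib F p n μ + (c : ℂ) * fib G p n μ := by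
  simp only [fib_apply, tfT]
  set f : E4 → ℂ := cpt F μ with hf
  set g : E4 → ℂ := fun x => (c : ℂ) * cpt G μ x with hg
  have hfi : Integrable f := (hF μ).ofReal
  have hgi : Integrable g := (hG μ).ofReal.const_mul _
  have hc : cpt (fun x ν => F x ν + c * G x ν) μ = fun x => f x + g x := by
    funext x; simp only [hf, hg, cpt]; push_cast; ring
  rw [hc, hatE_add hfi hgi, hg, hatE_const_mul, map_add, map_mul, Complex.conj_ofReal]
  ring

/-- **The Laplacian through the dictionary**: `(−ΔA)~|_p (n)_μ = |p + 2πn|² Ã_μ(p + 2πn)`. [cite: Federbush1986PhaseCellI, (3.5) p. 327] -/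
theorem fib_neg_laplacian (hA : ContDiff ℝ ∞ A) (hsupp : HasCompactSupport A) (p : Fin 4 → ℝ) (n : Fin 4 → ℤ) (μ : Fin 4) :
    fib (fun x ν => -(∑ j, pd (fun y ν' => pd A j ν' y) j ν x)) p n μ = lam p n * fib A p n μ := by
  rw [fib_apply, fib_apply, tfT]
  have : cpt (fun x ν => -(∑ j, pd (fun y ν' => pd A j ν' y) j ν x)) μ
      = fun x => ((-(∑ j, pd (fun y ν => pd A j ν y) j μ x) : ℝ) : ℂ) := rfl
  rw [this, hatE_neg_laplacian hA hsupp μ (shiftR p n), map_mul, map_sum]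
  simp only [map_pow, Complex.conj_ofReal, lam, csq, toC]
  ring

/-- **The penalty through the dictionary**: the fibre restriction of the transform of `Σ_γ χ_γ(χ_γ, A)` (geometric plaquettes)
is `Σ_a P̃_a(p + 2πn) ⟨a, Ã|_p⟩`. [cite: Federbush1986PhaseCellI, (3.5)–(3.7) p. 327, (3.10) p. 328] -/
theorem fib_penalty (hA : ContDiff ℝ ∞ A) (hsupp : HasCompactSupport A) {p : Fin 4 → ℝ}
    (hp : ∀ k (m : ℤ), p k ≠ 2 * Real.pi * m) (n : Fin 4 → ℤ) (μ : Fin 4) :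
    fib (fun x ν => ∑' ba : (Fin 4 → ℤ) × Fin 6,
        plaqTestField (plaqAt ba.1 ba.2) x ν * plaqFunctional 0 A (plaqAt ba.1 ba.2)) p n μ
      = ∑ a, Ptil a (shiftR p n) μ * pairing p a (fib A p) := by
  obtain ⟨S, hS⟩ := exists_finset_pairT_eq_zero hsupp
  have hcont := hA.continuous
  have hkj : ∀ j, shiftR p n j ≠ 0 := fun j => shiftR_ne_zero (hp j) n
  have hpair : ∀ a, pairing p a (fib A p)
      = ∑ m ∈ S, cexp (-I * ∑ k, (p k : ℂ) * (m k : ℂ)) * ((plaqFunctional 0 A (plaqAt m a) : ℝ) : ℂ) :=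
    fun a => pairing_fib_eq_sum hA hsupp hp a S (hS a)
  rw [fib_apply, tfT]
  have hc : cpt (fun x ν => ∑' ba : (Fin 4 → ℤ) × Fin 6,
        plaqTestField (plaqAt ba.1 ba.2) x ν * plaqFunctional 0 A (plaqAt ba.1 ba.2)) μ
      = fun x => ∑ ba ∈ S ×ˢ (Finset.univ : Finset (Fin 6)),
          ((plaqFunctional 0 A (plaqAt ba.1 ba.2) : ℝ) : ℂ) * ((plaqTestField (plaqAt ba.1 ba.2) x μ : ℝ) : ℂ) := by
    funext x
    simp only [cpt, tsum_penalty_eq_sum hcont hS x μ]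
    push_cast
    exact Finset.sum_congr rfl fun ba _ => mul_comm _ _
  rw [hc, hatE_finset_sum (S ×ˢ (Finset.univ : Finset (Fin 6)))
    (f := fun ba y => ((plaqFunctional 0 A (plaqAt ba.1 ba.2) : ℝ) : ℂ) * ((plaqTestField (plaqAt ba.1 ba.2) y μ : ℝ) : ℂ))
    (fun ba _ => (integrable_plaqTestField _ μ).ofReal.const_mul _)]
  simp_rw [hatE_const_mul, hatE_plaqTestField _ _ hkj μ, map_sum, map_mul, Complex.conj_conj, Complex.conj_ofReal,
    conj_cexp_phase, cexp_neg_phase_shiftR, hpair]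
  rw [Finset.sum_product, Finset.sum_comm, Finset.mul_sum]
  refine Finset.sum_congr rfl fun a _ => ?_
  rw [Finset.mul_sum, Finset.mul_sum]
  refine Finset.sum_congr rfl fun b _ => ?_
  simp only [Ptil]
  ring

/-- **(3.5) through the dictionary.** For a smooth compactly supported field `A`, every `α`, every real momentum `p ∉ 2πℤ⁴`
(coordinatewise), every fibre index `n` and component `μ`: the restriction to the fibre over `p` of the transform of
`DA = (−Δ + α²Σ_γ χ_γ(χ_γ, ·))A` (print's (3.5), geometric plaquettes) IS the fibre operator `opD α p` of `LandauPenaltyFibre`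
applied to `Ã|_p`: `(DA)~(p + 2πn)_μ = |p+2πn|² Ã_μ(p+2πn) + α² Σ_a P̃_a(p+2πn)_μ ⟨a, Ã|_p⟩`.
[cite: Federbush1986PhaseCellI, (3.5)–(3.7) p. 327, (3.10) p. 328] -/
theorem fib_opDPosFix (hA : ContDiff ℝ ∞ A) (hsupp : HasCompactSupport A) (α : ℝ) {p : Fin 4 → ℝ}
    (hp : ∀ k (m : ℤ), p k ≠ 2 * Real.pi * m) (n : Fin 4 → ℤ) (μ : Fin 4) :
    fib (opDPosFix α A) p n μ = opD α p (fib A p) n μ := by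
  obtain ⟨S, hS⟩ := exists_finset_pairT_eq_zero hsupp
  have hcont := hA.continuous
  have h1 : ∀ ν, Integrable fun x => -(∑ j, pd (fun y ν' => pd A j ν' y) j ν x) := fun ν =>
    (integrable_finsetSum (Finset.univ : Finset (Fin 4)) fun j _ =>
      (continuous_pd (contDiff_pdField hA j) j ν).integrable_of_hasCompactSupport
        (hasCompactSupport_pd (hasCompactSupport_pdField hsupp j) j ν)).neg
  have h2 : ∀ ν, Integrable fun x => ∑' ba : (Fin 4 → ℤ) × Fin 6,
      plaqTestField (plaqAt ba.1 ba.2) x ν * plaqFunctional 0 A (plaqAt ba.1 ba.2) := by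
    intro ν
    have : (fun x => ∑' ba : (Fin 4 → ℤ) × Fin 6,
        plaqTestField (plaqAt ba.1 ba.2) x ν * plaqFunctional 0 A (plaqAt ba.1 ba.2))
        = fun x => ∑ ba ∈ S ×ˢ (Finset.univ : Finset (Fin 6)),
            plaqTestField (plaqAt ba.1 ba.2) x ν * plaqFunctional 0 A (plaqAt ba.1 ba.2) :=
      funext fun x => tsum_penalty_eq_sum hcont hS x ν
    rw [this]
    exact integrable_finsetSum _ fun ba _ => (integrable_plaqTestField _ ν).mul_const _
  calc fib (opDPosFix α A) p n μ
      = fib (fun x ν => -(∑ j, pd (fun y ν' => pd A j ν' y) j ν x) + α ^ 2 * ∑' ba : (Fin 4 → ℤ) × Fin 6,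
          plaqTestField (plaqAt ba.1 ba.2) x ν * plaqFunctional 0 A (plaqAt ba.1 ba.2)) p n μ := rfl
    _ = lam p n * fib A p n μ + (α : ℂ) ^ 2 * ∑ a, Ptil a (shiftR p n) μ * pairing p a (fib A p) := by
        rw [fib_add_const_mul h1 h2, fib_neg_laplacian hA hsupp, fib_penalty hA hsupp hp]
        push_cast
        ring
    _ = opD α p (fib A p) n μ := rfl

/-- **«C = D⁻¹» (3.6) read in position space on the core**: for every smooth compactly supported field `A` and every `α`, the
printed momentum kernel (3.6) applied along the fibre to the transform of `DA` returns the transform of `A`: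
`C[(DA)~|_p] = Ã|_p` for every real `p ∉ 2πℤ⁴`. [cite: Federbush1986PhaseCellI, (3.5)–(3.6) p. 327] -/
theorem opC_fib_opDPosFix (hA : ContDiff ℝ ∞ A) (hsupp : HasCompactSupport A) (α : ℝ) {p : Fin 4 → ℝ}
    (hp : ∀ k (m : ℤ), p k ≠ 2 * Real.pi * m) : opC α p (fib (opDPosFix α A) p) = fib A p := by
  have h : fib (opDPosFix α A) p = opD α p (fib A p) :=
    funext fun n => funext fun μ => fib_opDPosFix hA hsupp α hp n μ
  rw [h]
  exact opC_opD hp α (fib A p) (summable_pairing_fib hA hsupp hp)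

/-- The same for the v3.111 all-orientations body `opDPos`: `(opDPos α A)~|_p = opD (√2·α) p (Ã|_p)`.
[cite: Federbush1986PhaseCellI, (3.5) p. 327, (3.9) p. 328] -/
theorem fib_opDPos (hA : ContDiff ℝ ∞ A) (hsupp : HasCompactSupport A) (α : ℝ) {p : Fin 4 → ℝ}
    (hp : ∀ k (m : ℤ), p k ≠ 2 * Real.pi * m) (n : Fin 4 → ℤ) (μ : Fin 4) :
    fib (opDPos α A) p n μ = opD (Real.sqrt 2 * α) p (fib A p) n μ := by
  have : opDPos α A = opDPosFix (Real.sqrt 2 * α) A :=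
    funext fun x => funext fun ν => LandauPenalty.opDPos_eq_opDPosFix hA.continuous α x ν
  rw [this]
  exact fib_opDPosFix hA hsupp _ hp n μ


/-! ## §5 (3.4) through the dictionary: `S = ∫_cell S_p dp` -/

/-! ### §5.1 The kinetic term: Plancherel and the cell decomposition -/

/-- `|Ã_μ(k)|² = (2π)⁻⁴ |Ψ_μ(k)|²`. [cite: Federbush1986PhaseCellI, (3.4) p. 327] -/
theorem normSq_ftil (A : E4 → Fin 4 → ℝ) (μ : Fin 4) (k : Fin 4 → ℝ) :
    Complex.normSq (ftil A μ k) = (1 / (2 * Real.pi) ^ 4) * ‖tfT A μ k‖ ^ 2 := by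
  rw [ftil_eq, Complex.normSq_mul, Complex.normSq_conj, Complex.normSq_eq_norm_sq, Complex.normSq_eq_norm_sq]
  have : ‖(1 / (2 * Real.pi) ^ 2 : ℂ)‖ = 1 / (2 * Real.pi) ^ 2 := by
    rw [show (1 / (2 * Real.pi) ^ 2 : ℂ) = ((1 / (2 * Real.pi) ^ 2 : ℝ) : ℂ) by push_cast; rfl, Complex.norm_real,
      Real.norm_eq_abs, abs_of_pos (by positivity)]
  rw [this]
  ring

/-- **Plancherel for one partial derivative**: `∫ (∂_jA_i)² d⁴x = ∫ k_j² |Ã_i(k)|² d⁴k`. [cite: Federbush1986PhaseCellI, (3.4) p. 327; SteinWeiss1971, Ch. I Thm 2.1] -/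
theorem integral_sq_pd_eq (hA : ContDiff ℝ ∞ A) (hsupp : HasCompactSupport A) (i j : Fin 4) :
    ∫ x, (pd A j i x) ^ 2 = ∫ k : Fin 4 → ℝ, (k j) ^ 2 * Complex.normSq (ftil A i k) := by
  have hg : ContDiff ℝ ∞ (fun x => ((pd A j i x : ℝ) : ℂ)) := contDiff_cpt (contDiff_pdField hA j) i
  have hs : HasCompactSupport (fun x => ((pd A j i x : ℝ) : ℂ)) := hasCompactSupport_cpt (hasCompactSupport_pdField hsupp j) i
  have hP := integral_norm_sq_hatE hg hs
  have h1 : ∀ k : Fin 4 → ℝ, ‖hatE (fun x => ((pd A j i x : ℝ) : ℂ)) k‖ ^ 2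
      = (2 * Real.pi) ^ 4 * ((k j) ^ 2 * Complex.normSq (ftil A i k)) := by
    intro k
    rw [hatE_pd hA hsupp j i k, normSq_ftil, norm_mul, norm_mul, norm_neg, Complex.norm_I, Complex.norm_real,
      Real.norm_eq_abs, one_mul, mul_pow, sq_abs]
    field_simp
  have h2 : ∀ x, ‖((pd A j i x : ℝ) : ℂ)‖ ^ 2 = (pd A j i x) ^ 2 := fun x => by
    rw [Complex.norm_real, Real.norm_eq_abs, sq_abs]
  simp_rw [h1, h2, integral_const_mul] at hP
  exact (mul_left_cancel₀ (by positivity) hP).symm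

/-- The momentum-space kinetic density `|k|² Σ_μ |Ã_μ(k)|²`. [cite: Federbush1986PhaseCellI, (3.4) p. 327] -/
def kinG (A : E4 → Fin 4 → ℝ) (k : Fin 4 → ℝ) : ℝ := (∑ j, (k j) ^ 2) * ∑ μ, Complex.normSq (ftil A μ k)

/-- On the fibre: `kinG(p + 2πn) = |p+2πn|² Σ_μ |(Ã|_p)(n)_μ|²`. [cite: Federbush1986PhaseCellI, (3.4) p. 327] -/
theorem kinG_shiftR (A : E4 → Fin 4 → ℝ) (p : Fin 4 → ℝ) (n : Fin 4 → ℤ) :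
    kinG A (shiftR p n) = lamR p n * ∑ μ, Complex.normSq (fib A p n μ) := rfl

/-- `kinG ≥ 0`. [cite: Federbush1986PhaseCellI, (3.4) p. 327] -/
theorem kinG_nonneg (A : E4 → Fin 4 → ℝ) (k : Fin 4 → ℝ) : 0 ≤ kinG A k :=
  mul_nonneg (Finset.sum_nonneg fun _ _ => sq_nonneg _) (Finset.sum_nonneg fun _ _ => Complex.normSq_nonneg _)

/-- `Ã_μ` is continuous for a smooth compactly supported field. [cite: Federbush1986PhaseCellI, (3.6) p. 327] -/
theorem continuous_ftil (hA : ContDiff ℝ ∞ A) (hsupp : HasCompactSupport A) (μ : Fin 4) : Continuous (ftil A μ) := by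
  have : ftil A μ = fun k => (1 / (2 * Real.pi) ^ 2 : ℂ) * conj (tfT A μ k) := funext fun k => ftil_eq A μ k
  rw [this]
  exact continuous_const.mul (Complex.continuous_conj.comp (continuous_tfT hA hsupp μ))

/-- `kinG` is continuous. [cite: Federbush1986PhaseCellI, (3.4) p. 327] -/
theorem continuous_kinG (hA : ContDiff ℝ ∞ A) (hsupp : HasCompactSupport A) : Continuous (kinG A) := by
  unfold kinG
  refine (continuous_finsetSum _ fun j _ => (continuous_apply j).pow 2).mul
    (continuous_finsetSum _ fun μ _ => Complex.continuous_normSq.comp (continuous_ftil hA hsupp μ))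

/-- **Isotropic decay of the kinetic density**: `kinG(k) ≤ C (1 + |k|²)⁻⁴`. [cite: FederbushWilliamson1987PhaseCellII, (6.8) p. 1418] -/
theorem exists_kinG_le (hA : ContDiff ℝ ∞ A) (hsupp : HasCompactSupport A) :
    ∃ C, 0 ≤ C ∧ ∀ k, kinG A k ≤ C * ((1 + ∑ j, (k j) ^ 2) ^ 4)⁻¹ := by
  choose C hC0 hC using fun μ => tfT_isotropic_decay hA hsupp μ
  refine ⟨∑ μ, C μ ^ 2, Finset.sum_nonneg fun μ _ => sq_nonneg _, fun k => ?_⟩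
  set S : ℝ := ∑ j, (k j) ^ 2 with hS
  set w : ℝ := ((1 + S) ^ 4)⁻¹ with hw
  have hS0 : 0 ≤ S := Finset.sum_nonneg fun j _ => sq_nonneg _
  have hw0 : 0 ≤ w := by rw [hw]; positivity
  have hw1 : w ≤ 1 := by
    rw [hw]; exact inv_le_one_of_one_le₀ (one_le_pow₀ (by linarith))
  have hSw : S * w ≤ 1 := by
    rw [hw, ← div_eq_mul_inv, div_le_one (by positivity)]
    nlinarith [one_le_pow₀ (by linarith : (1 : ℝ) ≤ 1 + S) (n := 3), hS0]
  have hterm : ∀ μ, Complex.normSq (ftil A μ k) ≤ C μ ^ 2 * w ^ 2 := by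
    intro μ
    rw [normSq_ftil]
    have h1 : ‖tfT A μ k‖ ^ 2 ≤ (C μ * w) ^ 2 := by
      have := hC μ k
      rw [← hS, ← hw] at this
      exact pow_le_pow_left₀ (norm_nonneg _) this 2
    have h2 : (1 / (2 * Real.pi) ^ 4 : ℝ) ≤ 1 := by
      rw [div_le_one (by positivity)]
      have : (1 : ℝ) ≤ 2 * Real.pi := by linarith [Real.pi_gt_three]
      exact one_le_pow₀ this
    calc (1 / (2 * Real.pi) ^ 4) * ‖tfT A μ k‖ ^ 2 ≤ 1 * (C μ * w) ^ 2 :=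
          mul_le_mul h2 h1 (sq_nonneg _) zero_le_one
      _ = C μ ^ 2 * w ^ 2 := by ring
  calc kinG A k = S * ∑ μ, Complex.normSq (ftil A μ k) := rfl
    _ ≤ S * ∑ μ, C μ ^ 2 * w ^ 2 := mul_le_mul_of_nonneg_left (Finset.sum_le_sum fun μ _ => hterm μ) hS0
    _ = (S * w) * w * ∑ μ, C μ ^ 2 := by rw [← Finset.sum_mul]; ring
    _ ≤ 1 * w * ∑ μ, C μ ^ 2 := by gcongr
    _ = (∑ μ, C μ ^ 2) * ((1 + ∑ j, (k j) ^ 2) ^ 4)⁻¹ := by rw [hw, hS]; ring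

/-- The complexified kinetic density has inverse-square product decay. [cite: FederbushWilliamson1987PhaseCellII, (6.8) p. 1418] -/
theorem hasInvSqDecay_kinG (hA : ContDiff ℝ ∞ A) (hsupp : HasCompactSupport A) :
    ∃ C, HasInvSqDecay (fun k => ((kinG A k : ℝ) : ℂ)) C := by
  obtain ⟨C, hC0, hC⟩ := exists_kinG_le hA hsupp
  refine ⟨C, HasInvSqDecay.of_isotropic hC0 fun k => ?_⟩
  rw [Complex.norm_real, Real.norm_eq_abs, abs_of_nonneg (kinG_nonneg A k)]
  exact hC k

/-- `kinG` is integrable on `ℝ⁴`. [cite: Federbush1986PhaseCellI, (3.4) p. 327] -/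
theorem integrable_kinG (hA : ContDiff ℝ ∞ A) (hsupp : HasCompactSupport A) :
    Integrable fun k => ((kinG A k : ℝ) : ℂ) := by
  obtain ⟨C, hC⟩ := hasInvSqDecay_kinG hA hsupp
  exact hC.integrable (Complex.continuous_ofReal.comp (continuous_kinG hA hsupp)).aestronglyMeasurable

/-- The periodised kinetic density `Σ_n |p+2πn|² Σ_μ|(Ã|_p)(n)_μ|²` (the first term of `penS`) is the real part of the
continuous periodisation of `kinG`, hence continuous. [cite: Federbush1986PhaseCellI, (3.4) p. 327] -/
theorem continuous_tsum_kin (hA : ContDiff ℝ ∞ A) (hsupp : HasCompactSupport A) :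
    Continuous fun p : Fin 4 → ℝ => ∑' n : Fin 4 → ℤ, lamR p n * ∑ μ, Complex.normSq (fib A p n μ) := by
  obtain ⟨C, hC⟩ := hasInvSqDecay_kinG hA hsupp
  have hc := hC.continuous_perSum (Complex.continuous_ofReal.comp (continuous_kinG hA hsupp))
  have heq : (fun p : Fin 4 → ℝ => ∑' n : Fin 4 → ℤ, lamR p n * ∑ μ, Complex.normSq (fib A p n μ))
      = fun p => (perSum (fun k => ((kinG A k : ℝ) : ℂ)) p).re := by
    funext p
    rw [perSum, ← Complex.ofReal_tsum, Complex.ofReal_re]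
    rfl
  rw [heq]
  exact Complex.continuous_re.comp hc

/-- **The kinetic term through the dictionary**: `∫ Σ_{i,j} (∂_jA_i)² d⁴x = ∫_cell Σ_n |p+2πn|² Σ_μ |Ã_μ(p+2πn)|² dp`
(Plancherel, then the decomposition of `ℝ⁴` into translates of the momentum cell). [cite: Federbush1986PhaseCellI, (3.4) p. 327, (3.6) p. 327 («Σ_n … δ(p − p′ − 2πn)»); SteinWeiss1971, Ch. I Thm 2.1] -/
theorem integral_kin_eq_cell (hA : ContDiff ℝ ∞ A) (hsupp : HasCompactSupport A) :
    ∫ x, ∑ i, ∑ j, (pd A j i x) ^ 2 = ∫ p in cell, ∑' n : Fin 4 → ℤ, lamR p n * ∑ μ, Complex.normSq (fib A p n μ) := by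
  have hsq : ∀ i j, (fun x : E4 => (pd A j i x) ^ 2) = (fun x => pd A j i x) * (fun x => pd A j i x) := fun i j => by
    funext x; simp [sq]
  have hcs : ∀ i j, HasCompactSupport (fun x : E4 => (pd A j i x) ^ 2) := fun i j => by
    rw [hsq]; exact (hasCompactSupport_pd hsupp j i).mul_left
  have hkin1 : ∀ i j, Integrable fun x : E4 => (pd A j i x) ^ 2 := fun i j =>
    ((continuous_pd hA j i).pow 2).integrable_of_hasCompactSupport (hcs i j)
  -- integrability of each momentum-space summand, by comparison with `kinG`
  have hGi : Integrable (kinG A) := by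
    have := (integrable_kinG hA hsupp).re
    simpa using this
  have hterm : ∀ i j, Integrable fun k : Fin 4 → ℝ => (k j) ^ 2 * Complex.normSq (ftil A i k) := by
    intro i j
    refine hGi.mono' ?_ (ae_of_all _ fun k => ?_)
    · exact (((continuous_apply j).pow 2).mul
        (Complex.continuous_normSq.comp (continuous_ftil hA hsupp i))).aestronglyMeasurable
    · rw [Real.norm_eq_abs, abs_of_nonneg (mul_nonneg (sq_nonneg _) (Complex.normSq_nonneg _)), kinG]
      exact mul_le_mul (Finset.single_le_sum (fun j _ => sq_nonneg (k j)) (Finset.mem_univ j))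
        (Finset.single_le_sum (fun μ _ => Complex.normSq_nonneg (ftil A μ k)) (Finset.mem_univ i))
        (Complex.normSq_nonneg _) (Finset.sum_nonneg fun j _ => sq_nonneg _)
  calc ∫ x, ∑ i, ∑ j, (pd A j i x) ^ 2
      = ∑ i, ∑ j, ∫ x, (pd A j i x) ^ 2 := by
        rw [integral_finsetSum _ fun i _ => integrable_finsetSum _ fun j _ => hkin1 i j]
        exact Finset.sum_congr rfl fun i _ => integral_finsetSum _ fun j _ => hkin1 i j
    _ = ∑ i, ∑ j, ∫ k : Fin 4 → ℝ, (k j) ^ 2 * Complex.normSq (ftil A i k) :=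
        Finset.sum_congr rfl fun i _ => Finset.sum_congr rfl fun j _ => integral_sq_pd_eq hA hsupp i j
    _ = ∫ k : Fin 4 → ℝ, ∑ i, ∑ j, (k j) ^ 2 * Complex.normSq (ftil A i k) := by
        rw [integral_finsetSum _ fun i _ => integrable_finsetSum _ fun j _ => hterm i j]
        exact Finset.sum_congr rfl fun i _ => (integral_finsetSum _ fun j _ => hterm i j).symm
    _ = ∫ k : Fin 4 → ℝ, kinG A k := by
        refine integral_congr_ae (ae_of_all _ fun k => ?_)
        simp only [kinG]
        rw [Finset.sum_comm, Finset.sum_mul_sum]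
    _ = ∫ p in cell, ∑' n : Fin 4 → ℤ, kinG A (shiftR p n) := by
        have h := integral_eq_integral_cell_tsum (integrable_kinG hA hsupp)
        rw [integral_complex_ofReal] at h
        simp_rw [← Complex.ofReal_tsum] at h
        rw [integral_complex_ofReal] at h
        exact_mod_cast h
    _ = ∫ p in cell, ∑' n : Fin 4 → ℤ, lamR p n * ∑ μ, Complex.normSq (fib A p n μ) := rfl

/-! ### §5.2 The penalty term: Parseval on the cell for finitely supported plaquette data -/

/-- The lattice Fourier series of finitely supported plaquette data is a finite sum. [cite: Federbush1986PhaseCellI, (3.11)–(3.12) p. 328] -/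
theorem betaHat_eq_sum {β : Plaq 0 → ℝ} {T : Finset (Fin 4 → ℤ)} (hT : ∀ q : Plaq 0, q.base ∉ T → β q = 0)
    (p : Fin 4 → ℝ) (a : Fin 6) :
    betaHat β p a = ∑ b ∈ T, cexp (-I * ∑ k, (p k : ℂ) * (b k : ℂ)) * ((β (plaqAt b a) : ℝ) : ℂ) := by
  refine tsum_eq_sum fun b hb => ?_
  rw [hT (plaqAt b a) hb, Complex.ofReal_zero, mul_zero]

/-- `conj e^{−ip·m} = e^{ip·m}`. [folklore] -/
private theorem conj_cexp_neg_phase (p : Fin 4 → ℝ) (m : Fin 4 → ℤ) :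
    conj (cexp (-I * ∑ k, (p k : ℂ) * (m k : ℂ))) = cexp (I * ∑ k, (p k : ℂ) * (m k : ℂ)) := by
  have h := congrArg conj (conj_cexp_phase p m)
  rw [Complex.conj_conj] at h
  exact h.symm

/-- **Parseval on the momentum cell for a trigonometric polynomial**: `∫_cell |Σ_{b∈T} c_b e^{−ip·b}|² dp = (2π)⁴ Σ_{b∈T} c_b²`
(real coefficients). [cite: SteinWeiss1971, Ch. VII §1 Thm 1.7; Federbush1986PhaseCellI, (3.4) p. 327] -/
theorem integral_cell_normSq_trigPoly (T : Finset (Fin 4 → ℤ)) (c : (Fin 4 → ℤ) → ℝ) :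
    ∫ p in cell, Complex.normSq (∑ b ∈ T, cexp (-I * ∑ k, (p k : ℂ) * (b k : ℂ)) * ((c b : ℝ) : ℂ))
      = (2 * Real.pi) ^ 4 * ∑ b ∈ T, (c b) ^ 2 := by
  have hchar : ∀ m : Fin 4 → ℤ, Continuous fun q : Fin 4 → ℝ => cexp (I * ∑ k, (q k : ℂ) * (m k : ℂ)) := fun m =>
    Complex.continuous_exp.comp (continuous_const.mul (continuous_finsetSum _ fun k _ =>
      (Complex.continuous_ofReal.comp (continuous_apply k)).mul continuous_const))
  have hterm : ∀ (b b' : Fin 4 → ℤ) (q : Fin 4 → ℝ),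
      cexp (I * ∑ k, (q k : ℂ) * (b k : ℂ)) * cexp (-I * ∑ k, (q k : ℂ) * (b' k : ℂ))
        = cexp (I * ∑ k, (q k : ℂ) * ((b - b') k : ℂ)) := by
    intro b b' q
    rw [← Complex.exp_add]
    congr 1
    simp only [Pi.sub_apply, Int.cast_sub]
    rw [Finset.mul_sum, Finset.mul_sum, Finset.mul_sum, ← Finset.sum_add_distrib]
    exact Finset.sum_congr rfl fun k _ => by ring
  -- complex computation
  have key : ∫ p in cell, ((Complex.normSq (∑ b ∈ T, cexp (-I * ∑ k, (p k : ℂ) * (b k : ℂ)) * ((c b : ℝ) : ℂ)) : ℝ) : ℂ)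
      = (2 * Real.pi : ℂ) ^ 4 * ∑ b ∈ T, ((c b : ℝ) : ℂ) ^ 2 := by
    have hexp : ∀ p : Fin 4 → ℝ,
        ((Complex.normSq (∑ b ∈ T, cexp (-I * ∑ k, (p k : ℂ) * (b k : ℂ)) * ((c b : ℝ) : ℂ)) : ℝ) : ℂ)
          = ∑ b ∈ T, ∑ b' ∈ T, ((c b : ℝ) : ℂ) * ((c b' : ℝ) : ℂ) * cexp (I * ∑ k, (p k : ℂ) * ((b - b') k : ℂ)) := by
      intro p
      rw [Complex.normSq_eq_conj_mul_self, map_sum, Finset.sum_mul_sum]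
      refine Finset.sum_congr rfl fun b _ => Finset.sum_congr rfl fun b' _ => ?_
      rw [map_mul, Complex.conj_ofReal, conj_cexp_neg_phase, ← hterm b b' p]
      ring
    simp_rw [hexp]
    rw [integral_finsetSum _ fun b _ => integrableOn_cell_of_continuous'
      (continuous_finsetSum _ fun b' _ => ((hchar (b - b')).const_mul _))]
    have hinner : ∀ b ∈ T, ∫ p in cell, ∑ b' ∈ T, ((c b : ℝ) : ℂ) * ((c b' : ℝ) : ℂ)
        * cexp (I * ∑ k, (p k : ℂ) * ((b - b') k : ℂ)) = (2 * Real.pi : ℂ) ^ 4 * ((c b : ℝ) : ℂ) ^ 2 := by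
      intro b hb
      rw [integral_finsetSum _ fun b' _ => integrableOn_cell_of_continuous' ((hchar (b - b')).const_mul _)]
      simp_rw [integral_const_mul, integral_cell_cexp_int, sub_eq_zero, mul_ite, mul_zero]
      rw [Finset.sum_ite_eq, if_pos hb]
      ring
    rw [Finset.sum_congr rfl hinner, ← Finset.mul_sum]
  rw [integral_complex_ofReal] at key
  exact_mod_cast key


/-- Lattice characters `p ↦ e^{−ip·m}` are continuous. [folklore] -/
private theorem continuous_cexp_neg_phase (m : Fin 4 → ℤ) :
    Continuous fun q : Fin 4 → ℝ => cexp (-I * ∑ k, (q k : ℂ) * (m k : ℂ)) :=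
  Complex.continuous_exp.comp (continuous_const.mul (continuous_finsetSum _ fun k _ =>
    (Complex.continuous_ofReal.comp (continuous_apply k)).mul continuous_const))

/-! ### §5.3 The penalty term through the dictionary, and (3.4) = `∫_cell penS` -/

/-- The data of the penalty term as a trigonometric polynomial on the cell: a finite corner set `T` and real coefficients
`c_a(b) = (χ_{⟨b,a⟩}, A) − β_{⟨b,a⟩}` with `⟨a, Ã|_p⟩ − β̂_a(p) = Σ_{b∈T} c_a(b) e^{−ip·b}` off the lattice hyperplanes and
`Σ_{(b,a)} ((χ_{⟨b,a⟩}, A) − β_{⟨b,a⟩})² = Σ_a Σ_{b∈T} c_a(b)²`. [cite: Federbush1986PhaseCellI, (3.4) p. 327, (3.11)–(3.12) p. 328] -/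
theorem exists_trigPoly_penalty (hA : ContDiff ℝ ∞ A) (hsupp : HasCompactSupport A) {β : Plaq 0 → ℝ}
    (hβfin : ∃ B : Finset (Fin 4 → ℤ), ∀ q : Plaq 0, q.base ∉ B → β q = 0) :
    ∃ (T : Finset (Fin 4 → ℤ)) (c : Fin 6 → (Fin 4 → ℤ) → ℝ),
      (∀ p : Fin 4 → ℝ, (∀ k (m : ℤ), p k ≠ 2 * Real.pi * m) → ∀ a,
        pairing p a (fib A p) - betaHat β p a = ∑ b ∈ T, cexp (-I * ∑ k, (p k : ℂ) * (b k : ℂ)) * ((c a b : ℝ) : ℂ))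
      ∧ ∑' ba : (Fin 4 → ℤ) × Fin 6, (plaqFunctional 0 A (plaqAt ba.1 ba.2) - β (plaqAt ba.1 ba.2)) ^ 2
          = ∑ a, ∑ b ∈ T, (c a b) ^ 2 := by
  obtain ⟨B, hB⟩ := hβfin
  obtain ⟨S, hS⟩ := exists_finset_pairT_eq_zero hsupp
  have hcont := hA.continuous
  have hST : ∀ a, ∀ m ∉ S ∪ B, pairT A a (latPt m) = 0 := fun a m hm => hS a m fun h => hm (Finset.mem_union_left B h)
  have hBT : ∀ q : Plaq 0, q.base ∉ S ∪ B → β q = 0 := fun q hq => hB q fun h => hq (Finset.mem_union_right S h)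
  refine ⟨S ∪ B, fun a b => plaqFunctional 0 A (plaqAt b a) - β (plaqAt b a), fun p hp a => ?_, ?_⟩
  · rw [pairing_fib_eq_sum hA hsupp hp a (S ∪ B) (hST a), betaHat_eq_sum hBT p a, ← Finset.sum_sub_distrib]
    refine Finset.sum_congr rfl fun b _ => ?_
    push_cast
    ring
  · rw [tsum_eq_sum (s := (S ∪ B) ×ˢ (Finset.univ : Finset (Fin 6))) fun ba hba => ?_, Finset.sum_product,
      Finset.sum_comm]
    have hb : ba.1 ∉ S ∪ B := fun h => hba (Finset.mem_product.mpr ⟨h, Finset.mem_univ _⟩)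
    rw [hBT (plaqAt ba.1 ba.2) hb, ← pairT_latPt hcont, hST ba.2 ba.1 hb]
    ring

/-- **The penalty term through the dictionary** (Parseval on the cell): `Σ_{(b,a)} ((χ_{⟨b,a⟩}, A) − β_{⟨b,a⟩})² =
(2π)⁻⁴ ∫_cell Σ_a |⟨a, Ã|_p⟩ − β̂_a(p)|² dp`. [cite: Federbush1986PhaseCellI, (3.4) p. 327; SteinWeiss1971, Ch. VII §1 Thm 1.7] -/
theorem tsum_penalty_eq_cell (hA : ContDiff ℝ ∞ A) (hsupp : HasCompactSupport A) {β : Plaq 0 → ℝ}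
    (hβfin : ∃ B : Finset (Fin 4 → ℤ), ∀ q : Plaq 0, q.base ∉ B → β q = 0) :
    ∑' ba : (Fin 4 → ℤ) × Fin 6, (plaqFunctional 0 A (plaqAt ba.1 ba.2) - β (plaqAt ba.1 ba.2)) ^ 2
      = (1 / (2 * Real.pi) ^ 4) * ∫ p in cell, ∑ a, Complex.normSq (pairing p a (fib A p) - betaHat β p a) := by
  obtain ⟨T, c, htrig, hsum⟩ := exists_trigPoly_penalty hA hsupp hβfin
  have h2 : ∀ a, ∑ b ∈ T, (c a b) ^ 2 = (1 / (2 * Real.pi) ^ 4) * ∫ p in cell,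
      Complex.normSq (∑ b ∈ T, cexp (-I * ∑ k, (p k : ℂ) * (b k : ℂ)) * ((c a b : ℝ) : ℂ)) := by
    intro a
    rw [integral_cell_normSq_trigPoly T (c a)]
    field_simp
  have hcont : ∀ a, Continuous fun p : Fin 4 → ℝ =>
      Complex.normSq (∑ b ∈ T, cexp (-I * ∑ k, (p k : ℂ) * (b k : ℂ)) * ((c a b : ℝ) : ℂ)) := fun a =>
    Complex.continuous_normSq.comp (continuous_finsetSum _ fun b _ => (continuous_cexp_neg_phase b).mul continuous_const)
  rw [hsum, Finset.sum_congr rfl fun a _ => h2 a, ← Finset.mul_sum,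
    ← integral_finsetSum _ fun a _ => integrableOn_cell_of_continuous' (hcont a)]
  congr 1
  refine setIntegral_congr_ae measurableSet_cell' ?_
  filter_upwards [ae_off_lattice] with p hp _
  exact Finset.sum_congr rfl fun a _ => by rw [htrig p hp a]

/-- The penalty density `Σ_a |⟨a, Ã|_p⟩ − β̂_a(p)|²` is integrable on the cell (a.e. a trigonometric polynomial).
[cite: Federbush1986PhaseCellI, (3.4) p. 327] -/
theorem integrableOn_penalty (hA : ContDiff ℝ ∞ A) (hsupp : HasCompactSupport A) {β : Plaq 0 → ℝ}
    (hβfin : ∃ B : Finset (Fin 4 → ℤ), ∀ q : Plaq 0, q.base ∉ B → β q = 0) :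
    IntegrableOn (fun p : Fin 4 → ℝ => ∑ a, Complex.normSq (pairing p a (fib A p) - betaHat β p a)) cell := by
  obtain ⟨T, c, htrig, -⟩ := exists_trigPoly_penalty hA hsupp hβfin
  have hcont : Continuous fun p : Fin 4 → ℝ =>
      ∑ a, Complex.normSq (∑ b ∈ T, cexp (-I * ∑ k, (p k : ℂ) * (b k : ℂ)) * ((c a b : ℝ) : ℂ)) :=
    continuous_finsetSum _ fun a _ => Complex.continuous_normSq.comp
      (continuous_finsetSum _ fun b _ => (continuous_cexp_neg_phase b).mul continuous_const)
  refine (integrableOn_cell_of_continuous' hcont).congr_fun_ae ?_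
  refine ae_restrict_of_ae ?_
  filter_upwards [ae_off_lattice] with p hp
  exact Finset.sum_congr rfl fun a _ => by rw [htrig p hp a]

/-- **(3.4) through the dictionary.** For a smooth compactly supported (Landau-gauge candidate) field `A′`, finitely supported
level-0 plaquette data `β` and every penalty `α`, print's penalised action IS the cell integral of its fibre density:
`S = ½∫Σ_{i,j}(∂_jA′_i)² + ½α²Σ_{p∈ℒ⁰}((χ_p, A′) − β_p)² = ∫_cell S_p[Ã′|_p] dp`, with
`S_p[f] = ½Σ_n|p+2πn|²|f(n)|² + ½α²(2π)⁻⁴Σ_a|⟨a,f⟩ − β̂_a(p)|²` the `penS` of `LandauPenaltyFibre` (Plancherel for the kinetic term,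
Poisson summation over the plaquette corners and Parseval on the momentum cell for the penalty).
[cite: Federbush1986PhaseCellI, (3.4)–(3.7) p. 327; SteinWeiss1971, Ch. I Thm 2.1, Ch. VII §2 Thm 2.4] -/
theorem penaltyActionFix_eq_integral_penS (hA : ContDiff ℝ ∞ A) (hsupp : HasCompactSupport A) {β : Plaq 0 → ℝ}
    (hβfin : ∃ B : Finset (Fin 4 → ℤ), ∀ q : Plaq 0, q.base ∉ B → β q = 0) (α : ℝ) :
    penaltyActionFix α β A = ∫ p in cell, penS α p (betaHat β p) (fib A p) := by
  have hK : IntegrableOn (fun p : Fin 4 → ℝ => ∑' n : Fin 4 → ℤ, lamR p n * ∑ μ, Complex.normSq (fib A p n μ)) cell :=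
    integrableOn_cell_of_continuous' (continuous_tsum_kin hA hsupp)
  have hQ := integrableOn_penalty hA hsupp hβfin
  have hpenS : ∀ p, penS α p (betaHat β p) (fib A p)
      = (1 / 2) * (∑' n : Fin 4 → ℤ, lamR p n * ∑ μ, Complex.normSq (fib A p n μ))
        + (1 / 2) * α ^ 2 * (1 / (2 * Real.pi) ^ 4) * ∑ a, Complex.normSq (pairing p a (fib A p) - betaHat β p a) :=
    fun p => rfl
  simp_rw [hpenS]
  rw [integral_add (hK.const_mul _) (hQ.const_mul _), integral_const_mul, integral_const_mul, penaltyActionFix,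
    integral_kin_eq_cell hA hsupp, tsum_penalty_eq_cell hA hsupp hβfin]
  ring

/-- Finitely supported bond data have finitely supported plaquette variables (a plaquette variable at corner `b` involves
the edges based at `b`, `b + e_i`, `b + e_j`). [cite: Federbush1986PhaseCellI, (1.6) p. 322, §3 p. 327] -/
theorem exists_finset_plaqOfBonds_eq_zero {e : Edge 0 → ℝ}
    (hefin : ∃ B : Finset (Fin 4 → ℤ), ∀ d : Edge 0, d.base ∉ B → e d = 0) :
    ∃ B' : Finset (Fin 4 → ℤ), ∀ q : Plaq 0, q.base ∉ B' → plaqOfBonds e q = 0 := by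
  obtain ⟨B, hB⟩ := hefin
  refine ⟨B ∪ Finset.univ.biUnion fun d : Fin 4 => B.image fun b => b - Pi.single d 1, fun q hq => ?_⟩
  rw [Finset.notMem_union] at hq
  have h0 : ∀ d, e ⟨q.base, d⟩ = 0 := fun d => hB _ hq.1
  have h1 : ∀ i d, e ⟨q.base + Pi.single i 1, d⟩ = 0 := by
    intro i d
    refine hB _ fun hmem => hq.2 ?_
    rw [Finset.mem_biUnion]
    exact ⟨i, Finset.mem_univ i, Finset.mem_image.mpr ⟨_, hmem, by simp⟩⟩
  simp [plaqOfBonds, h0, h1]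

/-- The same dictionary for the PLAQUETTE VARIABLES OF BOND DATA as `β` (print's single excitation: the level-0 plaquette
variables of a finitely supported bond assignment). [cite: Federbush1986PhaseCellI, (3.3)–(3.4) p. 327] -/
theorem penaltyActionFix_plaqOfBonds_eq_integral_penS (hA : ContDiff ℝ ∞ A) (hsupp : HasCompactSupport A)
    {e : Edge 0 → ℝ} (hefin : ∃ B : Finset (Fin 4 → ℤ), ∀ d : Edge 0, d.base ∉ B → e d = 0) (α : ℝ) :
    penaltyActionFix α (plaqOfBonds e) A = ∫ p in cell, penS α p (betaHat (plaqOfBonds e) p) (fib A p) :=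
  penaltyActionFix_eq_integral_penS hA hsupp (exists_finset_plaqOfBonds_eq_zero hefin) α

end PlaquetteGram

end

end Literature.MathematicalPhysics.QuantumFieldTheory.Federbush1986
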